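import Literature.AnabelianGeometry.SemiGraphs.PSCSmoothCurveGenuineRestrict
import Literature.AnabelianGeometry.SemiGraphs.PSCSmoothProperGenuineRank
import Literature.AnabelianGeometry.SemiGraphs.ProSigmaSurfaceTypeInvariance
import HarnessLib

/-!
# [CombGC] Rmk. 1.1.5 at genuine smooth-CURVE data: `M^unr_G[v]` is the pro-`Σ` completion of `ℤ^{2g}`

Mochizuki, *A combinatorial version of the Grothendieck conjecture* [CombGC], Tohoku Math. J. **59**
(2007), §1, Def. 1.1 (ii) p. 7 ("unramified quotient `Π^unr_G`", "`M_G := Π_G^{ab}`"), Rmk. 1.1.3 p. 8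
(connectedness: "`Π^grph_G` is … free pro-`Σ` … of rank `n(G) − i(G) + 1`"), Rmk. 1.1.5 p. 8 (the image
`M^unr_G[v]` of a verticial subgroup "is a free `Ẑ^Σ`-module of rank `2 g_v`" — "the well-known
structure of fundamental groups of Riemann surfaces"); [IUTchI] Rmk. 1.2.3 (iv) p. 42.
[cite: MochizukiCombGC2007, Rmk 1.1.5 p.8] [cite: MochizukiCombGC2007, Rmk 1.1.3 p.8]

PROOF-ONLY file (abc-iut cell, layer L3, [CombGC] non-vacuity programme; seat abc-iut-w5-d195 gen 7,
brick «SC-GENUINE-COVERING-CLOSED», part D; sequel of `PSCSmoothCurveGenuineOrigin.lean` and the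
smooth-PROPER twin `PSCSmoothProperGenuineRank.lean`).  At a GENUINE smooth-curve datum — profinite `Π`,
one vertex with `Π_v = Π`, no nodes, a pro-`Σ` completion `ι : Γ_{g,r} → Π` of a hyperbolic punctured
surface group, cusp groups conjugates of the closed cusp inertia groups `closure ι⟨c_j⟩`, `genus(v) = g`:

* `PuncturedSurfaceGroup.nonempty_mulEquiv_quotient_commutator_sup_cusps` — the group theory:
  `Γ_{g,r} ⧸ ([Γ,Γ] · ⟨⟨c_1, …, c_r⟩⟩) ≅ ℤ^{2g}` (the abelianisation with the cusps killed; `a_i, b_i`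
  ↦ the standard basis);
* `unrKer_eq_closure_map_of_smoothCurve'` — `Ker(Π ↠ Π^unr) = closure ι(⟨⟨c_1,…,c_r⟩⟩)`;
  `unrAbKer_eq_closure_map_of_smoothCurve'` — `Ker(Π ↠ M^unr) = closure ι([Γ,Γ]·⟨⟨c_j⟩⟩)`;
* `unrVertAbOfRank_of_smoothCurveGenuine` — **`UnrVertAbOfRank` HOLDS**: `M^unr_G[v] = Π ⧸ Ker(Π ↠ M^unr)`
  is the pro-`Σ` completion of `Γ_{g,r} ⧸ ([Γ,Γ]·⟨⟨c_j⟩⟩) ≅ ℤ^{2g}`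
  (`IsProSigmaCompletion.quotientMap_of_coe_eq_closure`);
* `vertCountLeNodeCountSucc_of_vertGp_eq_top` — Rmk. 1.1.3's `i(G_U) ≤ n(G_U) + 1` at one-vertex data
  with `Π_v = Π` (`i(G_U) = 1`);
* origin level: `unrVertAbOfRankHolds_of_smoothCurveGenuine`, `vertCountLeNodeCountSuccHolds_of_vertGp_eq_top`,
  `unrVerticialCharacterizationHolds'_of_vertGp_eq_top` (abc-iut-L3-t4's corrected [IUTchI]
  Rmk. 1.2.3 (iv) successor needs only one vertex with `Π_v = Π`); the joint statement at the
  covering-closed genuine smooth-curve origin `Ω_scg` of `PSCSmoothCurveGenuineOrigin.lean`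
  (`RestrictBDOfPSCTypeHolds ∧ UnrVertAbOfRankHolds ∧ UnrVerticialCharacterizationHolds' ∧ …`) is the
  sequel's assembly.

Consistency / non-vacuity evidence at genuine one-component data WITH cusps; not the printed theorems
for all pointed stable curves; 0 definitions; nothing here takes a side on [IUTchIII] Cor. 3.12.
-/

noncomputable section

/-! ### Group theory: the abelianisation of `Γ_{g,r}` with the cusps killed is `ℤ^{2g}` -/

namespace Literature.GroupTheory.CombinatorialGroupTheory.PuncturedSurfaceGroup

/-- **`Γ_{g,r} ⧸ ([Γ_{g,r},Γ_{g,r}] · ⟨⟨c_1,…,c_r⟩⟩) ≅ ℤ^{2g}`**: the quotient of the punctured surface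
group by its commutator subgroup and the normal closure of the cusp inertia groups is free abelian on
the images of `a_1, b_1, …, a_g, b_g` (the homomorphism `a_i ↦ e_{(i,0)}`, `b_i ↦ e_{(i,1)}`,
`c_j ↦ 0` kills the relator `[a_1,b_1]⋯[a_g,b_g]c_1⋯c_r`, and its inverse `e_{(i,·)} ↦ ā_i, b̄_i` is
well defined because the quotient is abelian) — `H_1` of the closed surface of genus `g`.
[cite: MochizukiCombGC2007, Rmk 1.1.5 p.8] -/
theorem nonempty_mulEquiv_quotient_commutator_sup_cusps (g r : ℕ) :
    Nonempty (((Fin g × Bool) → Multiplicative ℤ) ≃*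
      PuncturedSurfaceGroup g r ⧸ (commutator (PuncturedSurfaceGroup g r) ⊔
        Subgroup.normalClosure (⋃ j, (cuspInertia (g := g) (r := r) j : Set (PuncturedSurfaceGroup g r))))) := by
  classical
  let M : Subgroup (PuncturedSurfaceGroup g r) := commutator (PuncturedSurfaceGroup g r) ⊔
    Subgroup.normalClosure (⋃ j, (cuspInertia (g := g) (r := r) j : Set (PuncturedSurfaceGroup g r)))
  -- (1) `φ : Γ → ℤ^{2g}`, `a_i, b_i ↦` basis, `c_j ↦ 0`
  let f : puncturedSurfaceGen g r → ((Fin g × Bool) → Multiplicative ℤ) :=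
    Sum.elim (fun ib => Pi.mulSingle ib (Multiplicative.ofAdd 1)) (fun _ => 1)
  have hf : ∀ w ∈ ({relator g r} : Set (FreeGroup (puncturedSurfaceGen g r))), FreeGroup.lift f w = 1 := by
    intro w hw
    rw [Set.mem_singleton_iff.mp hw, lift_relator_eq_prod]
    exact Finset.prod_eq_one fun j _ => rfl
  let φ : PuncturedSurfaceGroup g r →* ((Fin g × Bool) → Multiplicative ℤ) := PresentedGroup.toGroup hf
  have hφa : ∀ ib : Fin g × Bool,
      φ (PresentedGroup.of (Sum.inl ib)) = Pi.mulSingle ib (Multiplicative.ofAdd 1) :=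
    fun ib => PresentedGroup.toGroup.of hf
  have hφc : ∀ j, φ (c (g := g) j) = 1 := fun j => PresentedGroup.toGroup.of hf
  have hcM : ∀ j, c (g := g) (r := r) j ∈ M := fun j =>
    Subgroup.mem_sup_right (Subgroup.subset_normalClosure (Set.mem_iUnion.mpr ⟨j, Subgroup.mem_zpowers _⟩))
  have hMφ : M ≤ φ.ker := by
    refine sup_le (Abelianization.commutator_subset_ker φ) (Subgroup.normalClosure_le_normal ?_)
    intro x hx
    obtain ⟨j, hj⟩ := Set.mem_iUnion.mp hx
    obtain ⟨k, rfl⟩ := Subgroup.mem_zpowers_iff.mp hj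
    rw [SetLike.mem_coe, MonoidHom.mem_ker, map_zpow]
    change φ (c j) ^ k = 1
    rw [hφc, one_zpow]
  let φbar : PuncturedSurfaceGroup g r ⧸ M →* ((Fin g × Bool) → Multiplicative ℤ) :=
    QuotientGroup.lift M φ hMφ
  -- (2) the quotient is abelian; `ψ : ℤ^{2g} → Γ ⧸ M`, `e_{(i,·)} ↦ ā_i, b̄_i`
  have hcomm : ∀ x y : PuncturedSurfaceGroup g r ⧸ M, Commute x y := by
    intro x y
    induction x using QuotientGroup.induction_on with
    | H u =>
      induction y using QuotientGroup.induction_on with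
      | H v =>
        rw [Commute, SemiconjBy, ← QuotientGroup.mk_mul, ← QuotientGroup.mk_mul, QuotientGroup.eq]
        refine Subgroup.mem_sup_left ?_
        have hmem := Subgroup.commutator_mem_commutator (H₁ := (⊤ : Subgroup (PuncturedSurfaceGroup g r)))
          (H₂ := ⊤) (Subgroup.mem_top v⁻¹) (Subgroup.mem_top u⁻¹)
        rw [commutatorElement_def, inv_inv, inv_inv] at hmem
        rw [show (u * v)⁻¹ * (v * u) = v⁻¹ * u⁻¹ * v * u by group]
        exact hmem
  let q : (Fin g × Bool) → PuncturedSurfaceGroup g r ⧸ M :=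
    fun ib => QuotientGroup.mk (PresentedGroup.of (Sum.inl ib))
  let ψ : ((Fin g × Bool) → Multiplicative ℤ) →* PuncturedSurfaceGroup g r ⧸ M :=
    MonoidHom.noncommPiCoprod (fun ib => zpowersHom _ (q ib)) (fun _ _ _ x y => hcomm _ _)
  have hψ : ∀ ib, ψ (Pi.mulSingle ib (Multiplicative.ofAdd 1)) = q ib := fun ib => by
    rw [MonoidHom.noncommPiCoprod_mulSingle, zpowersHom_apply, toAdd_ofAdd, zpow_one]
  -- (3) mutually inverse
  have h1 : φbar.comp ψ = MonoidHom.id _ := by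
    refine MonoidHom.functions_ext _ _ _ fun ib x => ?_
    suffices h : (φbar.comp ψ).comp (MonoidHom.mulSingle (fun _ : Fin g × Bool => Multiplicative ℤ) ib) =
        (MonoidHom.id ((Fin g × Bool) → Multiplicative ℤ)).comp
          (MonoidHom.mulSingle (fun _ : Fin g × Bool => Multiplicative ℤ) ib) from
      DFunLike.congr_fun h x
    refine MonoidHom.ext_mint ?_
    change φbar (ψ (Pi.mulSingle ib (Multiplicative.ofAdd 1))) = Pi.mulSingle ib (Multiplicative.ofAdd 1)
    rw [hψ]
    change QuotientGroup.lift M φ hMφ (QuotientGroup.mk _) = _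
    rw [QuotientGroup.lift_mk, hφa]
  have h2 : ψ.comp φbar = MonoidHom.id _ := by
    refine QuotientGroup.monoidHom_ext _ (PresentedGroup.ext fun s => ?_)
    change ψ (QuotientGroup.lift M φ hMφ (QuotientGroup.mk (PresentedGroup.of s))) =
      QuotientGroup.mk (PresentedGroup.of s)
    rw [QuotientGroup.lift_mk]
    rcases s with ib | j
    · rw [hφa, hψ]
    · change ψ (φ (c j)) = QuotientGroup.mk (c j)
      rw [hφc, map_one, eq_comm, QuotientGroup.eq_one_iff]
      exact hcM j
  exact ⟨MonoidHom.toMulEquiv ψ φbar h1 h2⟩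

end Literature.GroupTheory.CombinatorialGroupTheory.PuncturedSurfaceGroup

namespace Literature.AnabelianGeometry.SemiGraphs

namespace PSCDatum

open scoped Pointwise
open Literature.GroupTheory.CombinatorialGroupTheory
open Literature.GroupTheory.CombinatorialGroupTheory.PuncturedSurfaceGroup (cuspInertia IsHyperbolicType
  nonempty_mulEquiv_quotient_commutator_sup_cusps)
open SemiGraphOfAnabelioids (IsProSigmaCompletion)
open Literature.IUT.HodgeTheaters (profiniteCompletion toCompletion)

universe u

variable {P : Type u} [Group P] [TopologicalSpace P] [IsTopologicalGroup P]

/-! ### The unramified kernels at smooth-curve data -/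

section Kernels

variable (G : PSCDatum P) [IsEmpty G.graph.N] {Sigma : Set ℕ} {g r : ℕ}
  (ι : PuncturedSurfaceGroup g r →* P) (hι : IsProSigmaCompletion Sigma ι) (e : G.graph.C ≃ Fin r)
  (hC : ∀ c, ∃ δ : ConjAct P,
    G.cuspGp c = δ • ((cuspInertia (g := g) (e c)).map ι).topologicalClosure)
include hι hC

/-- **`Ker(Π_G ↠ Π^unr_G)` at smooth-curve data is the closure of `ι(⟨⟨c_1,…,c_r⟩⟩)`**: the closed
normal subgroup generated by the cusp groups `δ_c closure(ι⟨c_j⟩) δ_c⁻¹` (no nodes).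
[cite: MochizukiCombGC2007, Def 1.1(ii) p.7] -/
theorem unrKer_eq_closure_map_of_smoothCurve' :
    G.unrKer = ((Subgroup.normalClosure
      (⋃ j, (cuspInertia (g := g) (r := r) j : Set (PuncturedSurfaceGroup g r)))).map ι).topologicalClosure := by
  set N : Subgroup (PuncturedSurfaceGroup g r) :=
    Subgroup.normalClosure (⋃ j, (cuspInertia (g := g) (r := r) j : Set (PuncturedSurfaceGroup g r)))
    with hN
  haveI hMn : ((N.map ι).topologicalClosure).Normal :=
    IsProSigmaCompletion.normal_topologicalClosure_map hι.dense N
  have h0 : (⋃ e', (G.nodeGp e' : Set P)) = ∅ := Set.iUnion_of_empty _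
  unfold unrKer
  rw [h0, Set.union_empty]
  apply le_antisymm
  · -- every cusp group lies in the closed normal subgroup `closure ι(N)`
    refine Subgroup.topologicalClosure_minimal _ ?_ (Subgroup.isClosed_topologicalClosure _)
    refine Subgroup.normalClosure_le_normal ?_
    intro x hx
    obtain ⟨c, hc⟩ := Set.mem_iUnion.mp hx
    obtain ⟨δ, hδ⟩ := hC c
    have hle : G.cuspGp c ≤ (N.map ι).topologicalClosure := by
      rw [hδ, ← hMn.conjAct δ, Subgroup.pointwise_smul_le_pointwise_smul_iff]
      exact Subgroup.topologicalClosure_mono (Subgroup.map_mono fun y hy =>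
        Subgroup.subset_normalClosure (Set.mem_iUnion.mpr ⟨e c, hy⟩))
    exact hle hc
  · -- `ι(N) ⊆ normalClosure (⋃ Π_c)`: `ι⟨c_j⟩ ⊆ δ⁻¹ Π_c δ` for the cusp `c = e⁻¹ j`
    refine Subgroup.topologicalClosure_mono ?_
    rw [Subgroup.map_le_iff_le_comap]
    refine Subgroup.normalClosure_le_normal ?_
    intro x hx
    obtain ⟨j, hj⟩ := Set.mem_iUnion.mp hx
    rw [SetLike.mem_coe, Subgroup.mem_comap]
    obtain ⟨δ, hδ⟩ := hC (e.symm j)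
    rw [Equiv.apply_symm_apply] at hδ
    have hle : ((cuspInertia (g := g) j).map ι).topologicalClosure ≤
        Subgroup.normalClosure (⋃ c, (G.cuspGp c : Set P)) := by
      rw [← inv_smul_smul δ ((cuspInertia (g := g) j).map ι).topologicalClosure, ← hδ,
        ← (Subgroup.normalClosure_normal (s := ⋃ c, (G.cuspGp c : Set P))).conjAct δ⁻¹,
        Subgroup.pointwise_smul_le_pointwise_smul_iff]
      exact fun y hy => Subgroup.subset_normalClosure (Set.mem_iUnion.mpr ⟨e.symm j, hy⟩)
    exact hle (Subgroup.le_topologicalClosure _ (Subgroup.mem_map_of_mem ι hj))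

/-- **`Ker(Π_G ↠ M^unr_G) = closure ι([Γ,Γ] · ⟨⟨c_j⟩⟩)`** at smooth-curve data.
[cite: Mochizuki2012, IUTchI Rmk 1.2.3(iv) p.42] -/
theorem unrAbKer_eq_closure_map_of_smoothCurve' :
    G.unrAbKer = ((commutator (PuncturedSurfaceGroup g r) ⊔ Subgroup.normalClosure
      (⋃ j, (cuspInertia (g := g) (r := r) j : Set (PuncturedSurfaceGroup g r)))).map ι).topologicalClosure := by
  rw [unrAbKer, G.unrKer_eq_closure_map_of_smoothCurve' ι hι e hC, Subgroup.map_sup, ← commutator_def]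
  apply le_antisymm
  · refine Subgroup.topologicalClosure_minimal _ (sup_le ?_ ?_) (Subgroup.isClosed_topologicalClosure _)
    · exact (Subgroup.le_topologicalClosure _).trans
        ((IsProSigmaCompletion.topologicalClosure_map_commutator_eq hι.dense).symm.le.trans
          (Subgroup.topologicalClosure_mono le_sup_left))
    · exact Subgroup.topologicalClosure_mono le_sup_right
  · refine Subgroup.topologicalClosure_minimal _ (sup_le ?_ ?_) (Subgroup.isClosed_topologicalClosure _)
    · exact (IsProSigmaCompletion.map_commutator_le ι).trans
        (le_sup_left.trans (Subgroup.le_topologicalClosure _))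
    · exact (Subgroup.le_topologicalClosure _).trans
        (le_sup_right.trans (Subgroup.le_topologicalClosure _))

end Kernels

/-! ### Rmk. 1.1.5 at a genuine smooth-curve datum -/

/-- **[CombGC] Rmk. 1.1.5 HOLDS at a genuine smooth-curve datum**: for `G` over a profinite `Π` with no
nodes, `Π_v = Π` for all `v`, a pro-`Σ` completion `ι : Γ_{g,r} → Π` (`Σ = G.Sigma`), cusp groups
conjugates of the closed cusp inertia groups, and `genus(v) = g`, the rank statement `UnrVertAbOfRank`
holds — `M^unr_G[v] = Π ⧸ Ker(Π ↠ M^unr)` is the pro-`Σ` completion of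
`Γ_{g,r} ⧸ ([Γ,Γ]·⟨⟨c_j⟩⟩) ≅ ℤ^{2g}`. [cite: MochizukiCombGC2007, Rmk 1.1.5 p.8] -/
theorem unrVertAbOfRank_of_smoothCurveGenuine [T2Space P] (G : PSCDatum P) [IsEmpty G.graph.N]
    (hV : ∀ v, G.vertGp v = ⊤) {g r : ℕ} (ι : PuncturedSurfaceGroup g r →* P)
    (hι : IsProSigmaCompletion G.Sigma ι) (e : G.graph.C ≃ Fin r)
    (hC : ∀ c, ∃ δ : ConjAct P,
      G.cuspGp c = δ • ((cuspInertia (g := g) (e c)).map ι).topologicalClosure)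
    (hgen : ∀ v, G.genus v = g) : G.UnrVertAbOfRank := by
  classical
  intro v _
  set W : Subgroup P := G.unrVertAbOf v with hWdef
  have hW : W = ⊤ := G.unrVertAbOf_eq_top hV v
  -- `ι` co-restricted to `W = ⊤`
  have hmem : ∀ x, ι x ∈ W := fun x => by rw [hW]; exact Subgroup.mem_top _
  let ιW : PuncturedSurfaceGroup g r →* W := ι.codRestrict W hmem
  let eW : W ≃* P := (MulEquiv.subgroupCongr hW).trans Subgroup.topEquiv
  have he_apply : ∀ x : W, eW x = (x : P) := fun _ => rfl
  have he : Continuous eW := by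
    have : (eW : W → P) = Subtype.val := funext he_apply
    rw [this]; exact continuous_subtype_val
  have hes : Continuous eW.symm := by
    have : (eW.symm : P → W) = fun p => ⟨p, hW ▸ Subgroup.mem_top p⟩ := by
      funext p
      apply Subtype.ext
      change ((eW (eW.symm p)) : P) = p
      rw [MulEquiv.apply_symm_apply]
    rw [this]
    exact continuous_id.subtype_mk _
  have hιW : IsProSigmaCompletion G.Sigma ιW :=
    IsProSigmaCompletion.of_target_mulEquiv hι eW he hes fun _ => rfl
  -- the kernel `K = unrAbKer ∩ W` is the closure of `ιW([Γ,Γ]·⟨⟨c_j⟩⟩)`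
  set N' : Subgroup (PuncturedSurfaceGroup g r) := commutator (PuncturedSurfaceGroup g r) ⊔
    Subgroup.normalClosure (⋃ j, (cuspInertia (g := g) (r := r) j : Set (PuncturedSurfaceGroup g r)))
    with hN'
  set K : Subgroup W := (G.unrAbKer).subgroupOf W with hKdef
  have hK : (K : Set W) = closure (ιW '' ((N' : Subgroup _) : Set _)) := by
    rw [hKdef, Subgroup.coe_subgroupOf,
      Topology.IsEmbedding.subtypeVal.closure_eq_preimage_closure_image, Set.image_image]
    change Subtype.val ⁻¹' (G.unrAbKer : Set P) = Subtype.val ⁻¹' closure ((fun x => ι x) '' _)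
    rw [G.unrAbKer_eq_closure_map_of_smoothCurve' ι hι e hC, Subgroup.topologicalClosure_coe,
      Subgroup.coe_map]
  have hφ := IsProSigmaCompletion.quotientMap_of_coe_eq_closure hιW N' K hK
  -- re-index the source along `ℤ^{2 g_v} ≅ ℤ^{Fin g × Bool} ≅ Γ ⧸ N'`
  obtain ⟨eN⟩ := nonempty_mulEquiv_quotient_commutator_sup_cusps g r
  have hcard : Fintype.card (Fin g × Bool) = 2 * G.genus v := by
    rw [hgen, Fintype.card_prod, Fintype.card_fin, Fintype.card_bool, mul_comm]
  let eIdx : Fin (2 * G.genus v) ≃ (Fin g × Bool) := (Fintype.equivFinOfCardEq hcard).symm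
  let eFun : Multiplicative (Fin (2 * G.genus v) → ℤ) ≃* Multiplicative ((Fin g × Bool) → ℤ) :=
    AddEquiv.toMultiplicative (LinearEquiv.funCongrLeft ℤ ℤ eIdx).symm.toAddEquiv
  let eab : Multiplicative (Fin (2 * G.genus v) → ℤ) ≃* PuncturedSurfaceGroup g r ⧸ N' :=
    (eFun.trans (MulEquiv.funMultiplicative _ _)).trans eN
  have hle : N' ≤ K.comap ιW :=
    IsProSigmaCompletion.le_comap_of_image_subset
      (IsProSigmaCompletion.image_subset_of_coe_eq_closure hK)
  exact ⟨(QuotientGroup.map _ K ιW hle).comp eab.toMonoidHom,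
    IsProSigmaCompletion.of_comp_mulEquiv eab (fun _ => rfl) hφ⟩

/-! ### Rmk. 1.1.3 (connectedness of the coverings) at one-vertex data with `Π_v = Π` -/

omit [IsTopologicalGroup P] in
/-- **[CombGC] Rmk. 1.1.3 `i(G_U) ≤ n(G_U) + 1` at one-vertex data with `Π_v = Π`**: every covering
`G_U` has exactly one vertex (`U \ Π / Π = pt`). [cite: MochizukiCombGC2007, Rmk 1.1.3 p.8] -/
theorem vertCountLeNodeCountSucc_of_vertGp_eq_top (G : PSCDatum P) (hV : ∀ v, G.vertGp v = ⊤)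
    (v₀ : G.graph.V) (hv : ∀ w, w = v₀) : G.VertCountLeNodeCountSucc := by
  intro U _
  haveI : Subsingleton G.graph.V := ⟨fun a b => (hv a).trans (hv b).symm⟩
  haveI : Unique G.graph.V := uniqueOfSubsingleton v₀
  have h1 : G.vertCount U = 1 := by
    rw [vertCount, Fintype.sum_unique, hV, natCard_doubleCosetQuotient_top]
  omega

/-! ### Origin level -/

section Origin

variable (Ω : PSCOrigin.{u})

/-- **`UnrVertAbOfRankHolds` at every origin of genuine smooth-curve data.**
[cite: MochizukiCombGC2007, Rmk 1.1.5 p.8] -/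
theorem unrVertAbOfRankHolds_of_smoothCurveGenuine
    (hΩ : ∀ ⦃Q : Type u⦄ [Group Q] [TopologicalSpace Q] [IsTopologicalGroup Q] (G : PSCDatum Q),
      Ω.IsOfPSCType G → T2Space Q ∧ IsEmpty G.graph.N ∧ (∀ v, G.vertGp v = ⊤) ∧
        ∃ (g r : ℕ) (ι : PuncturedSurfaceGroup g r →* Q) (e : G.graph.C ≃ Fin r),
          IsProSigmaCompletion G.Sigma ι ∧ (∀ v, G.genus v = g) ∧
          ∀ c, ∃ δ : ConjAct Q, G.cuspGp c =
            δ • ((cuspInertia (g := g) (e c)).map ι).topologicalClosure) :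
    UnrVertAbOfRankHolds Ω := by
  intro Q _ _ _ G hG
  obtain ⟨ht, hN, hV, g, r, ι, e, hι, hgen, hC⟩ := hΩ G hG
  exact G.unrVertAbOfRank_of_smoothCurveGenuine hV ι hι e hC hgen

omit [IsTopologicalGroup P] in
/-- **`VertCountLeNodeCountSuccHolds` at every origin of one-vertex data with `Π_v = Π`.**
[cite: MochizukiCombGC2007, Rmk 1.1.3 p.8] -/
theorem vertCountLeNodeCountSuccHolds_of_vertGp_eq_top
    (hΩ : ∀ ⦃Q : Type u⦄ [Group Q] [TopologicalSpace Q] (G : PSCDatum Q), Ω.IsOfPSCType G →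
      (∀ v, G.vertGp v = ⊤) ∧ ∃ v₀ : G.graph.V, ∀ w, w = v₀) :
    VertCountLeNodeCountSuccHolds Ω := by
  intro Q _ _ _ G hG
  obtain ⟨hV, v₀, hv⟩ := hΩ G hG
  exact G.vertCountLeNodeCountSucc_of_vertGp_eq_top hV v₀ hv

omit [IsTopologicalGroup P] in
/-- **`UnrVerticialCharacterizationHolds'` at every origin of one-vertex data with `Π_v = Π`** (ANY
edges): abc-iut-L3-t4's corrected [IUTchI] Rmk. 1.2.3 (iv) split injection
`unrVerticialSplitInjection'_of_smoothProper` uses only the one vertex with `Π_v = Π`, and the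
elementary-quotient criterion `elementaryQuotientVerticiallyRamifiedIff` holds for every datum.
[cite: Mochizuki2012, IUTchI Rmk 1.2.3(iv) p.42] -/
theorem unrVerticialCharacterizationHolds'_of_vertGp_eq_top
    (hΩ : ∀ ⦃Q : Type u⦄ [Group Q] [TopologicalSpace Q] (G : PSCDatum Q), Ω.IsOfPSCType G →
      (∀ v, G.vertGp v = ⊤) ∧ ∃ v₀ : G.graph.V, ∀ w, w = v₀) :
    UnrVerticialCharacterizationHolds' Ω := by
  intro Q _ _ _ G hG
  obtain ⟨hV, v₀, hv⟩ := hΩ G hG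
  exact ⟨G.unrVerticialSplitInjection'_of_smoothProper hV v₀ hv, G.elementaryQuotientVerticiallyRamifiedIff⟩

end Origin

end PSCDatum

end Literature.AnabelianGeometry.SemiGraphs

end
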